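import Mathlib
import HarnessLib
import Summits.AtomisticToContinuum.FouriersLaw.Theses.JunctionLocality
import Summits.AtomisticToContinuum.FouriersLaw.Theorems.JunctionLocalitySuperadditiveResistanceKuboCombination

/-!
# Kubo–Onsager for the γ-thermostatted pinned chain, VIII: the quadratic form — completion of the square

Helper file (`--supports` stmt-AtomisticToContinuum-11748) for stub `stub_kuboOnsager` of the line
`floating-probe-bypass-laplacian` (crux `JunctionLocality.SuperadditiveResistance`). TERMINAL FRAME: `m` terminals
on distinct sites `s : Fin m → Fin L` of the pinned chain `𝐏 = pinnedChain ω₂ lam β γ` (`ω₂ > 0`, `lam, β ≥ 0`),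
all thermostatted at `T > 0` with friction `c > 0` (`B = termWeight s`), and terminal forward fields `g_a`
(`σ X_H g_a + c S_B g_a = −(p_{s_a}² − T)`, `g_a ∈ C² ∩ L²(μ_T)`). For `θ : Fin m → ℝ` put `g_θ = Σ θ_a g_a`,
`k_θ = Σ θ_a (p_{s_a}² − T)`.

* `square_completion` — the identity behind positivity of entropy production:
  `c T Σ_a ∫ (∂_{p_{s_a}} g_θ)² ρ + c T Σ_a ∫ (∂_{p_{s_a}} g_θ − (θ_a/c) p_{s_a})² ρ = (T²/c) |θ|² ∫ ρ`,
  together with the fluctuation–dissipation value `∫ g_θ k_θ ρ = c T Σ_a ∫ (∂_{p_{s_a}} g_θ)² ρ`.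
* `integral_comb_kinetic_le` — hence `∫ g_θ k_θ ρ ≤ (T²/c) |θ|² ∫ ρ` (the Kubo matrix
  `c δ_ab − (c²/T²)⟨g_a, p_{s_b}² − T⟩_{μ_T}` is POSITIVE SEMIDEFINITE);
* `partialP_comb_eq_of_extremal` — and in the equality case `∂_{p_{s_a}} g_θ = (θ_a/c) p_{s_a}` identically.
Part IX turns the equality case into `θ = const` (KERNEL = CONSTANTS) by the landed Liouville propagation.
References: folklore (second law at linear response); Eckmann–Pillet–Rey-Bellet 1999.
-/

noncomputable section

open MeasureTheory Filter Topology ProbabilityTheory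
open scoped ContDiff NNReal ENNReal
open Literature.MathematicalPhysics.KineticTheory.HeatConduction
open Summit.AtomisticToContinuum.FouriersLaw.Theorems.SuperadditiveResistance.DeviceLiouville

namespace Summit.AtomisticToContinuum.FouriersLaw.Theorems.SuperadditiveResistance.Kubo

section Definite

variable {ω₂ lam β γ : ℝ} {L m : ℕ}

set_option hygiene false in
/-- Local shorthand for the pinned chain of this section. -/
local notation "𝐏" => pinnedChain ω₂ lam β γ

/-- `∂_{p_i}(κ p_i) = κ`. [folklore] -/
theorem partialP_const_mul_snd (κ : ℝ) (i : Fin L) (x : PhaseSpace L) :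
    partialP i (fun y : PhaseSpace L => κ * y.2 i) x = κ := by
  simp [partialP]

/-- Expansion of `∫ (u − κ p_i)² ρ` for `u, p_i ∈ L²`. [folklore] -/
theorem integral_sub_sq_mul_gibbsDensity (hω : 0 < ω₂) (hl : 0 ≤ lam) (hβ : 0 ≤ β) (L : ℕ) {T : ℝ} (hT : 0 < T)
    {u : PhaseSpace L → ℝ} (hu : MemLp u 2 ((𝐏).gibbsMeasure L T)) (κ : ℝ) (i : Fin L) :
    ∫ x, (u x - κ * x.2 i) ^ 2 * (𝐏).gibbsDensity L T x =
      (∫ x, u x ^ 2 * (𝐏).gibbsDensity L T x) - 2 * κ * (∫ x, x.2 i * u x * (𝐏).gibbsDensity L T x) +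
        κ ^ 2 * ∫ x, x.2 i ^ 2 * (𝐏).gibbsDensity L T x := by
  have hp := memLp_momentum (γ := γ) hω hl hβ L hT i
  have hI1 : Integrable fun x => u x ^ 2 * (𝐏).gibbsDensity L T x := integrable_sq_mul_gibbsDensity hω hl hβ γ L hT hu
  have hI2 : Integrable fun x => x.2 i * u x * (𝐏).gibbsDensity L T x :=
    integrable_mul_mul_gibbsDensity hω hl hβ γ L hT hp hu
  have hI3 : Integrable fun x => x.2 i ^ 2 * (𝐏).gibbsDensity L T x := integrable_sq_mul_gibbsDensity hω hl hβ γ L hT hp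
  have hIsub : Integrable fun x => u x ^ 2 * (𝐏).gibbsDensity L T x -
      2 * κ * (x.2 i * u x * (𝐏).gibbsDensity L T x) := hI1.sub (hI2.const_mul _)
  have hpt : (fun x => (u x - κ * x.2 i) ^ 2 * (𝐏).gibbsDensity L T x) = fun x =>
      (u x ^ 2 * (𝐏).gibbsDensity L T x - 2 * κ * (x.2 i * u x * (𝐏).gibbsDensity L T x)) +
        κ ^ 2 * (x.2 i ^ 2 * (𝐏).gibbsDensity L T x) := by
    funext x; ring
  rw [hpt, integral_add hIsub (hI3.const_mul _), integral_sub hI1 (hI2.const_mul _), integral_const_mul,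
    integral_const_mul]

/-- **Completion of the square.** In the terminal frame, for every `θ`:
(i) `∫ g_θ k_θ ρ = c T Σ_a ∫ (∂_{p_{s_a}} g_θ)² ρ` and
(ii) `c T Σ_a ∫ (∂_{p_{s_a}} g_θ)² ρ + c T Σ_a ∫ (∂_{p_{s_a}} g_θ − (θ_a/c) p_{s_a})² ρ = (T²/c) |θ|² ∫ ρ`. [folklore] -/
theorem square_completion (hω : 0 < ω₂) (hl : 0 ≤ lam) (hβ : 0 ≤ β) (L : ℕ) {T : ℝ} (hT : 0 < T)
    (s : Fin m → Fin L) (hs : Function.Injective s) (σ : ℝ) {c : ℝ} (hc : 0 < c)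
    {g : Fin m → PhaseSpace L → ℝ} (hg : ∀ a, ContDiff ℝ 2 (g a)) (hgL : ∀ a, MemLp (g a) 2 ((𝐏).gibbsMeasure L T))
    (hpde : ∀ a x, σ * liouvilleOp 𝐏 L (g a) x + c * bathOp L (termWeight s) T (g a) x = -(x.2 (s a) ^ 2 - T))
    (θ : Fin m → ℝ) :
    (∫ x, comb θ g x * comb θ (fun a y => y.2 (s a) ^ 2 - T) x * (𝐏).gibbsDensity L T x =
      c * T * ∑ a, ∫ x, partialP (s a) (comb θ g) x ^ 2 * (𝐏).gibbsDensity L T x) ∧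
    c * T * (∑ a, ∫ x, partialP (s a) (comb θ g) x ^ 2 * (𝐏).gibbsDensity L T x) +
      c * T * (∑ a, ∫ x, (partialP (s a) (comb θ g) x - θ a / c * x.2 (s a)) ^ 2 * (𝐏).gibbsDensity L T x) =
      T ^ 2 / c * (∑ a, θ a ^ 2) * ∫ x, (𝐏).gibbsDensity L T x := by
  set B := termWeight s with hBdef
  have hB0 : ∀ i, 0 ≤ B i := termWeight_nonneg s
  have hBpos : ∀ a, 0 < B (s a) := termWeight_pos s hs
  set gθ := comb θ g with hgθdef
  set kθ : PhaseSpace L → ℝ := comb θ (fun a y => y.2 (s a) ^ 2 - T) with hkθdef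
  have hgθ : ContDiff ℝ 2 gθ := contDiff_comb θ hg
  have hgθ1 : ContDiff ℝ 1 gθ := hgθ.of_le (by norm_cast)
  have hgθL : MemLp gθ 2 ((𝐏).gibbsMeasure L T) := memLp_comb θ hgL
  have hkθL : MemLp kθ 2 ((𝐏).gibbsMeasure L T) := memLp_comb θ fun a => memLp_kinetic hω hl hβ L hT (s a)
  have hpθ : ∀ x, σ * liouvilleOp 𝐏 L gθ x + c * bathOp L B T gθ x = -kθ x :=
    comb_pair (pinnedChain ω₂ lam β γ) B T σ c θ hg hpde
  have hd2 : ∀ a, MemLp (partialP (s a) gθ) 2 ((𝐏).gibbsMeasure L T) := fun a =>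
    memLp_partialP hω hl hβ γ L hT B hB0 σ hc hgθ hgθL hkθL hpθ (hBpos a)
  have hp2 : ∀ a, MemLp (fun x : PhaseSpace L => x.2 (s a)) 2 ((𝐏).gibbsMeasure L T) := fun a =>
    memLp_momentum hω hl hβ L hT (s a)
  -- named quantities
  set Z : ℝ := ∫ x, (𝐏).gibbsDensity L T x with hZ
  set I : ℝ := ∫ x, gθ x * kθ x * (𝐏).gibbsDensity L T x with hI
  set D : Fin m → ℝ := fun a => ∫ x, partialP (s a) gθ x ^ 2 * (𝐏).gibbsDensity L T x with hD
  set Pa : Fin m → ℝ := fun a => ∫ x, x.2 (s a) * partialP (s a) gθ x * (𝐏).gibbsDensity L T x with hPa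
  set Q : Fin m → ℝ := fun a => ∫ x, (partialP (s a) gθ x - θ a / c * x.2 (s a)) ^ 2 * (𝐏).gibbsDensity L T x
    with hQ
  -- (FD): I = cT Σ_a D_a
  have hFD : I = c * T * ∑ a, D a := by
    have h := fluctuation_dissipation hω hl hβ L hT B hB0 σ hc hgθ hgθL hkθL hpθ
    simp only [hI, hD]
    rw [h, sum_termWeight_mul s fun i => ∫ x, partialP i gθ x ^ 2 * (𝐏).gibbsDensity L T x]
  -- (G): I = T Σ_a θ_a P_a
  have hG : I = T * ∑ a, θ a * Pa a := by
    have hIa : ∀ a, Integrable fun x => (x.2 (s a) ^ 2 - T) * gθ x * (𝐏).gibbsDensity L T x := fun a =>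
      integrable_mul_mul_gibbsDensity hω hl hβ γ L hT (memLp_kinetic hω hl hβ L hT (s a)) hgθL
    have hsplit : I = ∑ a, θ a * ∫ x, (x.2 (s a) ^ 2 - T) * gθ x * (𝐏).gibbsDensity L T x := by
      simp only [hI]
      have hpt : (fun x => gθ x * kθ x * (𝐏).gibbsDensity L T x) =
          fun x => ∑ a, θ a * ((x.2 (s a) ^ 2 - T) * gθ x * (𝐏).gibbsDensity L T x) := by
        funext x
        simp only [hkθdef, comb_apply, Finset.mul_sum, Finset.sum_mul]
        refine Finset.sum_congr rfl fun a _ => ?_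
        ring
      rw [hpt, integral_finsetSum _ fun a _ => (hIa a).const_mul _]
      refine Finset.sum_congr rfl fun a _ => ?_
      exact integral_const_mul _ _
    rw [hsplit, Finset.mul_sum]
    refine Finset.sum_congr rfl fun a _ => ?_
    rw [gauss_ibp hω hl hβ L hT (s a) hgθ1 hgθL (hd2 a)]
    ring
  -- second moments
  have hM : ∀ a, ∫ x, x.2 (s a) ^ 2 * (𝐏).gibbsDensity L T x = T * Z := fun a =>
    integral_sq_mul_gibbsDensity_eq hω hl hβ L hT (s a)
  -- expansion of Q_a
  have hQexp : ∀ a, Q a = D a - 2 * (θ a / c) * Pa a + (θ a / c) ^ 2 * (T * Z) := by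
    intro a
    simp only [hQ, hD, hPa]
    rw [integral_sub_sq_mul_gibbsDensity hω hl hβ L hT (hd2 a) (θ a / c) (s a), hM a]
  have hsumQ : ∑ a, Q a = (∑ a, D a) - 2 / c * (∑ a, θ a * Pa a) + T * Z / c ^ 2 * ∑ a, θ a ^ 2 := by
    simp only [hQexp, Finset.sum_add_distrib, Finset.sum_sub_distrib, Finset.mul_sum]
    congr 1
    · congr 1
      exact Finset.sum_congr rfl fun a _ => by ring
    · exact Finset.sum_congr rfl fun a _ => by ring
  have hSP : T * ∑ a, θ a * Pa a = c * T * ∑ a, D a := by rw [← hG, hFD]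
  refine ⟨hFD, ?_⟩
  have hc0 : c ≠ 0 := hc.ne'
  have e1 : c * T * ∑ a, Q a =
      c * T * (∑ a, D a) - 2 * T * (∑ a, θ a * Pa a) + T ^ 2 * Z / c * ∑ a, θ a ^ 2 := by
    rw [hsumQ]
    field_simp
  rw [e1]
  linear_combination (-2) * hSP

/-- **Positive semidefiniteness.** In the terminal frame: `∫ g_θ k_θ ρ ≤ (T²/c) |θ|² ∫ ρ`. [folklore] -/
theorem integral_comb_kinetic_le (hω : 0 < ω₂) (hl : 0 ≤ lam) (hβ : 0 ≤ β) (L : ℕ) {T : ℝ} (hT : 0 < T)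
    (s : Fin m → Fin L) (hs : Function.Injective s) (σ : ℝ) {c : ℝ} (hc : 0 < c)
    {g : Fin m → PhaseSpace L → ℝ} (hg : ∀ a, ContDiff ℝ 2 (g a)) (hgL : ∀ a, MemLp (g a) 2 ((𝐏).gibbsMeasure L T))
    (hpde : ∀ a x, σ * liouvilleOp 𝐏 L (g a) x + c * bathOp L (termWeight s) T (g a) x = -(x.2 (s a) ^ 2 - T))
    (θ : Fin m → ℝ) :
    ∫ x, comb θ g x * comb θ (fun a y => y.2 (s a) ^ 2 - T) x * (𝐏).gibbsDensity L T x ≤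
      T ^ 2 / c * (∑ a, θ a ^ 2) * ∫ x, (𝐏).gibbsDensity L T x := by
  obtain ⟨hFD, hSQ⟩ := square_completion hω hl hβ L hT s hs σ hc hg hgL hpde θ
  have hQ0 : 0 ≤ c * T * ∑ a, ∫ x, (partialP (s a) (comb θ g) x - θ a / c * x.2 (s a)) ^ 2 *
      (𝐏).gibbsDensity L T x := by
    refine mul_nonneg (mul_nonneg hc.le hT.le) (Finset.sum_nonneg fun a _ => integral_nonneg fun x => ?_)
    exact mul_nonneg (sq_nonneg _) ((𝐏).gibbsDensity_pos L T x).le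
  linarith

/-- **The equality case fixes the momentum derivatives at the terminals**: if
`∫ g_θ k_θ ρ = (T²/c)|θ|² ∫ ρ` then `∂_{p_{s_a}} g_θ (x) = (θ_a/c) p_{s_a}` for all `a`, `x`. [folklore] -/
theorem partialP_comb_eq_of_extremal (hω : 0 < ω₂) (hl : 0 ≤ lam) (hβ : 0 ≤ β) (L : ℕ) {T : ℝ} (hT : 0 < T)
    (s : Fin m → Fin L) (hs : Function.Injective s) (σ : ℝ) {c : ℝ} (hc : 0 < c)
    {g : Fin m → PhaseSpace L → ℝ} (hg : ∀ a, ContDiff ℝ 2 (g a)) (hgL : ∀ a, MemLp (g a) 2 ((𝐏).gibbsMeasure L T))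
    (hpde : ∀ a x, σ * liouvilleOp 𝐏 L (g a) x + c * bathOp L (termWeight s) T (g a) x = -(x.2 (s a) ^ 2 - T))
    (θ : Fin m → ℝ)
    (hext : ∫ x, comb θ g x * comb θ (fun a y => y.2 (s a) ^ 2 - T) x * (𝐏).gibbsDensity L T x =
      T ^ 2 / c * (∑ a, θ a ^ 2) * ∫ x, (𝐏).gibbsDensity L T x) (a : Fin m) (x : PhaseSpace L) :
    partialP (s a) (comb θ g) x = θ a / c * x.2 (s a) := by
  obtain ⟨hFD, hSQ⟩ := square_completion hω hl hβ L hT s hs σ hc hg hgL hpde θ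
  have hgθ1 : ContDiff ℝ 1 (comb θ g) := (contDiff_comb θ hg).of_le (by norm_cast)
  have hρpos : ∀ y, 0 < (𝐏).gibbsDensity L T y := fun y => (𝐏).gibbsDensity_pos L T y
  set Q : Fin m → ℝ := fun b => ∫ y, (partialP (s b) (comb θ g) y - θ b / c * y.2 (s b)) ^ 2 *
    (𝐏).gibbsDensity L T y with hQ
  have hQnn : ∀ b, 0 ≤ Q b := fun b => integral_nonneg fun y => mul_nonneg (sq_nonneg _) (hρpos y).le
  have hsum0 : ∑ b, Q b = 0 := by
    have hcT : 0 < c * T := mul_pos hc hT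
    have h1 : c * T * ∑ b, Q b = 0 := by linarith
    rcases mul_eq_zero.mp h1 with h | h
    · exact absurd h hcT.ne'
    · exact h
  have hQa : Q a = 0 := (Finset.sum_eq_zero_iff_of_nonneg fun b _ => hQnn b).mp hsum0 a (Finset.mem_univ a)
  -- a continuous non-negative function with zero integral vanishes
  have hF : Continuous fun y => (partialP (s a) (comb θ g) y - θ a / c * y.2 (s a)) ^ 2 * (𝐏).gibbsDensity L T y := by
    have := continuous_partialP hgθ1 one_ne_zero (s a)
    have := pinnedChain_continuous_gibbsDensity ω₂ lam β γ L T
    fun_prop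
  have hd2 : MemLp (partialP (s a) (comb θ g)) 2 ((𝐏).gibbsMeasure L T) := by
    have hB0 : ∀ i, 0 ≤ termWeight s i := termWeight_nonneg s
    exact memLp_partialP hω hl hβ γ L hT (termWeight s) hB0 σ hc (contDiff_comb θ hg) (memLp_comb θ hgL)
      (memLp_comb θ fun b => memLp_kinetic hω hl hβ L hT (s b)) (comb_pair (pinnedChain ω₂ lam β γ) _ T σ c θ hg hpde)
      (termWeight_pos s hs a)
  have hInt : Integrable fun y => (partialP (s a) (comb θ g) y - θ a / c * y.2 (s a)) ^ 2 *
      (𝐏).gibbsDensity L T y := by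
    have hsub : MemLp (fun y => partialP (s a) (comb θ g) y - θ a / c * y.2 (s a)) 2 ((𝐏).gibbsMeasure L T) :=
      hd2.sub ((memLp_momentum hω hl hβ L hT (s a)).const_mul (θ a / c))
    exact integrable_sq_mul_gibbsDensity hω hl hβ γ L hT hsub
  have hzero := (integral_eq_zero_iff_of_nonneg (fun y => mul_nonneg (sq_nonneg _) (hρpos y).le) hInt).mp hQa
  haveI := isAddHaarMeasure_volume_phaseSpace L
  have hfun := (Continuous.ae_eq_iff_eq volume hF continuous_const).mp hzero
  have hx : (partialP (s a) (comb θ g) x - θ a / c * x.2 (s a)) ^ 2 * (𝐏).gibbsDensity L T x = 0 :=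
    congr_fun hfun x
  rcases mul_eq_zero.mp hx with h | h
  · have := pow_eq_zero_iff two_ne_zero |>.mp h
    linarith
  · exact absurd h (hρpos x).ne'

end Definite

/-- Registered helper sub-goal `helper_kuboSquareCompletion` of stub `stub_kuboOnsager` (= `integral_comb_kinetic_le` in stub form; line
`floating-probe-bypass-laplacian`, crux stmt-AtomisticToContinuum-11748). [folklore] -/
theorem helper_kuboSquareCompletion : ∀ {ω₂ lam β γ : ℝ} {m : ℕ}, 0 < ω₂ → 0 ≤ lam → 0 ≤ β → ∀ (L : ℕ) {T : ℝ}, 0 < T → ∀ (s : Fin m → Fin L), Function.Injective s → ∀ (σ : ℝ) {c : ℝ}, 0 < c → ∀ {g : Fin m → PhaseSpace L → ℝ}, (∀ a, ContDiff ℝ 2 (g a)) → (∀ a, MemLp (g a) 2 ((pinnedChain ω₂ lam β γ).gibbsMeasure L T)) → (∀ a x, σ * liouvilleOp (pinnedChain ω₂ lam β γ) L (g a) x + c * bathOp L (termWeight s) T (g a) x = -(x.2 (s a) ^ 2 - T)) → ∀ (θ : Fin m → ℝ), ∫ x, comb θ g x * comb θ (fun a y => y.2 (s a) ^ 2 - T)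 x * (pinnedChain ω₂ lam β γ).gibbsDensity L T x ≤ T ^ 2 / c * (∑ a, θ a ^ 2) * ∫ x, (pinnedChain ω₂ lam β γ).gibbsDensity L T x :=
  @integral_comb_kinetic_le

end Summit.AtomisticToContinuum.FouriersLaw.Theorems.SuperadditiveResistance.Kubo

end
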